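import Literature.AlgebraicGeometry.HodgeTheory.FermatInductiveClaims
import HarnessLib

/-!
# Aoki's `p`-standard character `σ_{p,a}` as an explicit function, and the fourfold instance of Thm. 2-1 in the route's spelling

Family `hodge`, layer `Literature/AlgebraicGeometry/HodgeTheory`. PROVED glue over the named facts of
`FermatInductiveClaims` (Aoki, J. Math. Soc. Japan 39 (1987) 385–396, text read pp. 385–389: CLAIM(α)
p. 385, `σ_{p,i}` p. 387, Thm. 2-1 p. 388, §3 standing notation `m = pd`, p. 389); NO new named fact
is introduced (D-0026: the facts `Aoki1987_claim_pStandard`, `Aoki1987_claim_juxtaposition`,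
`Aoki1987_claim_of_claim_juxtaposition_paired`, `Shioda_claim_paired` already landed there).

* `FermatCharacter.aokiStandard r m a` — Aoki's `p`-standard element
  `σ_{p,a} = (a, a + d, a + 2d, …, a + (p-1)d, -pa)`, `p = 2r + 1`, `d = m / p`, as an honest
  character `Fin (p + 1) → ℤ/m` of `X^{p-1}ₘ = X²ʳₘ` in Aoki's order of coordinates (`Fin.snoc`:
  last coordinate `-pa`), with its coordinate formulas, the identity
  `univ.val.map (aokiStandard r m a) = (range p).map (k ↦ a + k d) + {-(p a)}` (the multiset
  hypothesis of `Aoki1987_claim_pStandard`), and `sum_aokiStandard`: its coordinates sum to `0`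
  when `p ∣ m` (`Σ_{k<p} (a + kd) - pa = d·p(p-1)/2 = m·r`), i.e. `σ_{p,a} ∈ Ĝ^{p-1}ₘ` (p. 385).
* `Aoki1987_claim_pStandard.aokiStandard` — Thm. 2-1 for the explicit character: claim(σ_{p,a}).
* `Aoki1987_claim_pStandard.four` — **the Fermat-FOURFOLD instance (`p = 5`, `r = 2`) in the exact
  spelling of the route items** `ShiodaAokiSupply` / `K3Exhaustion` of
  `Summits/HodgeConjecture/HodgeConjecture/Theses/DerivedTorelliFermat` (their `5`-standard parts are
  the multisets `{a, a + d, a + 2d, a + 3d, a + 4d, -(5a)}`, `d = ((m / 5 : ℕ) : ZMod m)`): for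
  `5 ∣ m`, `2 < m / 5`, `(⟨a⟩, m/5) = 1` and any `σ : Fin 6 → ℤ/m` with that multiset of values,
  `fermatEigenspace m σ (2 * 2) ≤ algebraicClasses (fermatHypersurface (2 * 2) m) 2`.
  (The route's side condition is `5 < m`; the printed one, kept by the fact, is `d/(a,d) = d > 2`,
  i.e. `m ≥ 15` — at `m = 10` the `5`-standard sextuple `{a, a+2, a+4, a+6, a+8, 5}` (`a` odd) is a
  juxtaposition of pairs and is covered by `Shioda_claim_paired` instead.)

## References

* [Aoki1987] N. Aoki, Some new algebraic cycles on Fermat varieties, J. Math. Soc. Japan 39 (1987)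
  385–396, §1 p. 387 (σ_{p,i}), Thm. 2-1 p. 388, §3 p. 389 (text read).
-/

noncomputable section

open Finset

namespace Literature.AlgebraicGeometry.HodgeTheory

open Literature.AlgebraicGeometry.Motives Literature.AlgebraicTopology.SingularHomology

namespace FermatCharacter

/-- **Aoki's `p`-standard element `σ_{p,a} = (a, a + d, a + 2d, …, a + (p-1)d, -pa)`**, `p = 2r + 1`,
`d = m / p`, as a character `Fin (p + 1) → ℤ/m` of `X^{p-1}ₘ = X²ʳₘ` in Aoki's order of coordinates
(last coordinate `-pa`). [cite: Aoki1987, §1 (definition of σ_{p,i}, p. 387) and Thm. 2-1 (p. 388)] -/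
def aokiStandard (r m : ℕ) (a : ZMod m) : Fin (2 * r + 2) → ZMod m :=
  Fin.snoc (α := fun _ ↦ ZMod m)
    (fun i : Fin (2 * r + 1) ↦ a + ((i : ℕ) : ZMod m) * ((m / (2 * r + 1) : ℕ) : ZMod m))
    (-((((2 * r + 1 : ℕ)) : ZMod m) * a))

/-- The first `p = 2r + 1` coordinates of `σ_{p,a}` are `a + i d`. [cite: Aoki1987, Thm. 2-1 (p. 388)] -/
@[simp] theorem aokiStandard_castSucc (r m : ℕ) (a : ZMod m) (i : Fin (2 * r + 1)) :
    aokiStandard r m a i.castSucc = a + ((i : ℕ) : ZMod m) * ((m / (2 * r + 1) : ℕ) : ZMod m) := by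
  simp [aokiStandard]

/-- The last coordinate of `σ_{p,a}` is `-pa`. [cite: Aoki1987, Thm. 2-1 (p. 388)] -/
@[simp] theorem aokiStandard_last (r m : ℕ) (a : ZMod m) :
    aokiStandard r m a (Fin.last (2 * r + 1)) = -(((2 * r + 1 : ℕ) : ZMod m) * a) := by
  simp [aokiStandard]

/-- **The multiset of values of `σ_{p,a}`** is `{a + kd : 0 ≤ k < p} + {-(pa)}` — the hypothesis
shape of the named fact `Aoki1987_claim_pStandard`. [cite: Aoki1987, Thm. 2-1 (p. 388)] -/
theorem univ_val_map_aokiStandard (r m : ℕ) (a : ZMod m) :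
    univ.val.map (aokiStandard r m a) =
      (Multiset.range (2 * r + 1)).map
          (fun k : ℕ ↦ a + (k : ZMod m) * ((m / (2 * r + 1) : ℕ) : ZMod m)) +
        {-(((2 * r + 1 : ℕ) : ZMod m) * a)} := by
  have hl : List.ofFn (aokiStandard r m a) =
      (List.range (2 * r + 1)).map
          (fun k : ℕ ↦ a + (k : ZMod m) * ((m / (2 * r + 1) : ℕ) : ZMod m)) ++
        [-(((2 * r + 1 : ℕ) : ZMod m) * a)] := by
    rw [List.ofFn_succ', List.concat_eq_append, List.ofFn_eq_map, ← List.map_coe_finRange_eq_range,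
      List.map_map]
    simp [aokiStandard, Function.comp_def]
  rw [Fin.univ_val_map, hl, ← Multiset.coe_add, Multiset.coe_singleton, ← Multiset.map_coe]
  rfl

/-- **`σ_{p,a} ∈ Ĝ^{p-1}ₘ`: its coordinates sum to `0`** when `p ∣ m`:
`Σ_{k<p} (a + kd) - pa = d·p(p-1)/2 = m·r ≡ 0 (mod m)` (`p = 2r + 1` odd).
[cite: Aoki1987, Introduction (p. 385: Ĝ = {Σ aᵢ = 0}) and §1 (p. 387)] -/
theorem sum_aokiStandard {r m : ℕ} (h : 2 * r + 1 ∣ m) (a : ZMod m) :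
    ∑ i, aokiStandard r m a i = 0 := by
  have hS : (∑ i ∈ Finset.range (2 * r + 1), i) = (2 * r + 1) * r := by
    apply Nat.eq_of_mul_eq_mul_right (show 0 < 2 by norm_num)
    rw [Finset.sum_range_id_mul_two, Nat.add_sub_cancel]
    ring
  have hcast : (∑ i : Fin (2 * r + 1), ((i : ℕ) : ZMod m)) * ((m / (2 * r + 1) : ℕ) : ZMod m) = 0 := by
    rw [Fin.sum_univ_eq_sum_range (fun i : ℕ ↦ (i : ZMod m)) (2 * r + 1), ← Nat.cast_sum, hS,
      ← Nat.cast_mul, mul_comm ((2 * r + 1) * r) (m / (2 * r + 1)), ← mul_assoc,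
      Nat.div_mul_cancel h, Nat.cast_mul, ZMod.natCast_self, zero_mul]
  rw [Fin.sum_univ_castSucc]
  simp only [aokiStandard_castSucc, aokiStandard_last, Finset.sum_add_distrib, Finset.sum_const,
    Finset.card_univ, Fintype.card_fin, nsmul_eq_mul, ← Finset.sum_mul, hcast]
  ring

end FermatCharacter

/-! ### Theorem 2-1 for the explicit character, and the fourfold instance in the route's spelling -/

/-- **Aoki 1987, Thm. 2-1 for the explicit character `σ_{p,a}`**: granted the named fact
`Aoki1987_claim_pStandard`, for `p = 2r + 1` prime, `p ∣ m`, `d = m/p > 2` and `(⟨a⟩, d) = 1`,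
claim(σ_{p,a}) holds on `X^{p-1}ₘ = X²ʳₘ`. [cite: Aoki1987, Thm. 2-1 (p. 388)] -/
theorem Aoki1987_claim_pStandard.aokiStandard (h : Aoki1987_claim_pStandard) {r m : ℕ} [NeZero m]
    (hp : (2 * r + 1).Prime) (hdvd : 2 * r + 1 ∣ m) (hd : 2 < m / (2 * r + 1)) {a : ZMod m}
    (ha : Nat.Coprime a.val (m / (2 * r + 1))) :
    FermatCharacter.Claim m r (FermatCharacter.aokiStandard r m a) :=
  h m (2 * r + 1) r hp rfl hdvd hd a ha _ (FermatCharacter.univ_val_map_aokiStandard r m a)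

/-- **The Fermat-fourfold instance of Aoki's Thm. 2-1 (`p = 5`, `r = 2`) in the spelling of the
route items `ShiodaAokiSupply` / `K3Exhaustion` of `Theses/DerivedTorelliFermat`**: granted the named
fact, for `5 ∣ m`, `2 < m/5`, `(⟨a⟩, m/5) = 1` and every character `σ : Fin 6 → ℤ/m` of `X⁴ₘ` whose
multiset of values is the route's `5`-standard sextuple `{a, a + d, a + 2d, a + 3d, a + 4d, -(5a)}`,
`d = ((m/5 : ℕ) : ℤ/m)`, the eigenline `V(σ) ⊆ H⁴(X⁴ₘ(ℂ); ℂ)` consists of algebraic classes.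
[cite: Aoki1987, Thm. 2-1 (p. 388), p = 5] -/
theorem Aoki1987_claim_pStandard.four (h : Aoki1987_claim_pStandard) {m : ℕ} [NeZero m]
    (h5 : 5 ∣ m) (hd : 2 < m / 5) {a : ZMod m} (ha : Nat.Coprime a.val (m / 5))
    (σ : Fin (2 * 2 + 2) → ZMod m)
    (hσ : univ.val.map σ =
      ({a, a + ((m / 5 : ℕ) : ZMod m), a + 2 * ((m / 5 : ℕ) : ZMod m), a + 3 * ((m / 5 : ℕ) : ZMod m),
        a + 4 * ((m / 5 : ℕ) : ZMod m), -(5 * a)} : Multiset (ZMod m))) :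
    fermatEigenspace m σ (2 * 2) ≤ algebraicClasses (fermatHypersurface (2 * 2) m) 2 := by
  refine h m 5 2 (by decide) rfl h5 hd a ha σ ?_
  rw [hσ]
  have hr : Multiset.range 5 = {0, 1, 2, 3, 4} := by decide
  rw [hr]
  simp only [Multiset.insert_eq_cons, Multiset.map_cons, Multiset.map_singleton, Nat.cast_ofNat,
    Nat.cast_one, Nat.cast_zero, one_mul, zero_mul, add_zero, Multiset.cons_add,
    Multiset.singleton_add]


end Literature.AlgebraicGeometry.HodgeTheory

end
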